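import Summits.CriticalPhenomena.PercolationContinuityZ3.Theorems.PercNearOneGluingNoHeavyPcintNawMemZ3M12Check1
import Summits.CriticalPhenomena.PercolationContinuityZ3.Theorems.PercNearOneGluingNoHeavyPcintNawMemZ3M12Check2
import Summits.CriticalPhenomena.PercolationContinuityZ3.Theorems.PercNearOneGluingNoHeavyPcintNawMemZ3M12Check3
import Summits.CriticalPhenomena.PercolationContinuityZ3.Theorems.PercNearOneGluingNoHeavyPcintNawMemZ3M12Check4
import HarnessLib

/-!
# PCINT lane, kernel reduced-state B2r certificate `Z3M12` (d = 3, memory τ = 12, 3907 state classes): the theorem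

Cell `prim-pcint`, seat `prim-pcint-1` (gen 5); memo `run/shared/lean/prim/pcint/INTERVAL-PLAN.md` §16 ("checker for the reduced-state
automata").  Does NOT build on p205010.  Data for `NawK.le_siteCriticalProb_of_checkRows` (`…PcintNawRandMemKernelCert`): `p = 25000/100000`,
`q̄ = 94409/100000` (`q̄^5·100000^5 ≥ (100000-25000)·100000^4`), `κ̄ = (100000+94409)/(2·100000)`, `λ = 99999/100000`; Collatz–Wielandt weights (scale 10⁹) from a
power iteration, exact off-line max row ratio 0.9999488843 < λ.  Generated by gen5/gen_lean.py (pcint-1 folder); the kernel re-checks every row.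
-/

namespace Summit.CriticalPhenomena.PercolationContinuityZ3.Theorems.Pcint

open Literature.Probability.Percolation Literature.Probability.LatticeModels

/-- Every row of the certificate passes. [folklore] -/
theorem NawMemZ3M12.all_rows : WinK.allRange (NawK.checkRow 12 3 3907 25000 94409 100000 99999 100000 NawMemZ3M12.syms NawMemZ3M12.tree) 0 3907 = true := (WinK.allRange_split (WinK.allRange_split (WinK.allRange_split NawMemZ3M12.file_1 NawMemZ3M12.file_2) NawMemZ3M12.file_3) NawMemZ3M12.file_4)

/-- **`p_c^site(ℤ³) ≥ 0.25 = 1/4`** (kernel-checked reduced-state B2r certificate: memory-`12` dangerous-set automaton,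
3907 state classes, `decide +kernel` only). [folklore] -/
theorem siteCriticalProb_Z3_ge_025 : (0.25 : ℝ) ≤ siteCriticalProb (zdGraph 3) 0 := by
  have h := NawK.le_siteCriticalProb_of_checkRows (d := 3) (τ := 12) (N := 3907) (pn := 25000) (Q := 94409) (D := 100000)
    (lamN := 99999) (lamD := 100000) (syms := NawMemZ3M12.syms) (t := NawMemZ3M12.tree) (by norm_num)
    (fun c => NawK.symOfTab 3 (NawMemZ3M12.syms.getD c [])) (NawK.syms_spec_of_valid NawMemZ3M12.syms_valid)
    (fun i hi => WinK.of_allRange NawMemZ3M12.all_rows (Nat.zero_le i) hi)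
    (by norm_num) (by decide +kernel) (by norm_num) (by norm_num) (by norm_num) (by norm_num) (by norm_num)
  have e : ((25000 : ℕ) : ℝ) / ((100000 : ℕ) : ℝ) = (0.25 : ℝ) := by norm_num
  rw [e] at h
  exact h

/-- **`p_c^site(ℤ³) ≥ 1/4`** (the same bound as a fraction). [folklore] -/
theorem siteCriticalProb_Z3_ge_quarter : (1 / 4 : ℝ) ≤ siteCriticalProb (zdGraph 3) 0 :=
  le_of_eq_of_le (by norm_num) siteCriticalProb_Z3_ge_025

end Summit.CriticalPhenomena.PercolationContinuityZ3.Theorems.Pcint
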